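import Summits.ResolutionOfSingularities.ResolutionOfSingularities.Theorems.CleanCoversCoverResolutionBinaryPatchingOverField
import Summits.ResolutionOfSingularities.ResolutionOfSingularities.Theorems.UniversalCellsLocalToGlobalCoverPatchingOfTrdegLe
import HarnessLib

/-!
# Route CleanCovers — crux `CoverResolution` (stmt-ResolutionOfSingularities-15104), line
# `strategy-split` (v2.1): certificate `binaryPatchingOverField_of_trdegLe`

Dimension-graded binary patching of resolvable opens over a field. Let `k` be a field and `n : ℕ`
such that any two proper models of any function field `K/k` (essentially of finite type) of
transcendence degree `≤ n` are dominated by a proper model `RegLe` over both, `X` an integral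
separated `k`-scheme of finite type with `dim X ≤ n`, and `X = U ∪ V` an open cover by two opens
each admitting a resolution of singularities. Then `X` admits a resolution of singularities.

This is the dimension-graded twin of `stub_binaryPatchingOverField`
(`CleanCoversCoverResolutionBinaryPatchingOverField.lean`), with the same two-step proof:

* extend the resolutions of `U` and of `V` to integral proper birational models `Z₁ → X`,
  `Z₂ → X` regular over `U`, resp. `V`
  (`exists_integral_partialResolution_of_hasResolution_opens`, landed);
* patch them by two-model patching in transcendence degree `≤ n`, which suffices because
  `dim X ≤ n` (`stub_coverPatching_of_trdegLe`,
  `UniversalCellsLocalToGlobalCoverPatchingOfTrdegLe.lean`, landed).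

## References

* O. Zariski, Ann. of Math. 45 (1944) 472–542, Fundamental Theorem p. 539. [Zariski1944]
* O. Piltant, RACSAM 107 (2013) 91–121, Prop. 5.1. [Piltant2013]
-/

-- single-problem summit: the doubled namespace component `ResolutionOfSingularities` is forced
set_option linter.dupNamespace false

noncomputable section

open CategoryTheory AlgebraicGeometry TopologicalSpace
open Literature.AlgebraicGeometry.Resolution

namespace Summit.ResolutionOfSingularities.ResolutionOfSingularities.Theorems

/-- **Dimension-graded binary patching of resolvable opens over a field** (Zariski 1944,
Fundamental Theorem p. 539, in the form of Piltant 2013, Prop. 5.1, graded by dimension). Let `k`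
be a field and `n : ℕ` such that any two proper models of a function field `K/k` with
`trdeg_k K ≤ n` are dominated by a proper model `RegLe` over both. If `X` is an integral separated
`k`-scheme of finite type with `dim X ≤ n` and `X = U ∪ V` with `U` and `V` admitting resolutions
of singularities, then `X` admits a resolution of singularities: extend both resolutions to
integral proper birational models of `X` regular over `U`, resp. `V`
(`exists_integral_partialResolution_of_hasResolution_opens`), and patch them in transcendence
degree `≤ n` (`stub_coverPatching_of_trdegLe`).
[cite: Zariski1944, Fundamental Theorem p. 539; Piltant2013, Prop. 5.1] -/
theorem binaryPatchingOverField_of_trdegLe : ∀ (k : Type) [Field k] (n : ℕ), (∀ (K : Type) [Field K] [Algebra k K] [Algebra.EssFiniteType k K], Algebra.trdeg k K ≤ n → ∀ (M₁ M₂ : Literature.AlgebraicGeometry.Resolution.ProperModel k K), ∃ (N : Literature.AlgebraicGeometry.Resolution.ProperModel k K) (φ₁ : N.Hom M₁) (φ₂ : N.Hom M₂), φ₁.RegLe ∧ φ₂.RegLe) → ∀ (X : AlgebraicGeometry.Scheme.{0}) (g : X ⟶ AlgebraicGeometry.Spec (.of k)), AlgebraicGeometry.IsSeparated g → AlgebraicGeometry.LocallyOfFiniteType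 g → AlgebraicGeometry.QuasiCompact g → AlgebraicGeometry.IsIntegral X → topologicalKrullDim X ≤ n → ∀ U V : X.Opens, U ⊔ V = ⊤ → Literature.AlgebraicGeometry.Resolution.Scheme.HasResolution (U : AlgebraicGeometry.Scheme.{0}) → Literature.AlgebraicGeometry.Resolution.Scheme.HasResolution (V : AlgebraicGeometry.Scheme.{0}) → Literature.AlgebraicGeometry.Resolution.Scheme.HasResolution X := by
  intro k _ n hT X g hs hl hq hi hX U V hUV hU hV
  haveI := hs
  haveI := hl
  haveI := hq
  haveI := hi
  -- extend the two local resolutions to integral proper birational models of `X`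
  obtain ⟨Z₁, π₁, hZ₁, hπ₁, hb₁, hr₁⟩ :=
    exists_integral_partialResolution_of_hasResolution_opens k X g U hU
  obtain ⟨Z₂, π₂, hZ₂, hπ₂, hb₂, hr₂⟩ :=
    exists_integral_partialResolution_of_hasResolution_opens k X g V hV
  haveI := hZ₁
  haveI := hπ₁
  haveI := hZ₂
  haveI := hπ₂
  -- patch them by two-model patching of proper models of transcendence degree `≤ n` over `k`
  exact stub_coverPatching_of_trdegLe k n hT X g hX U V hUV π₁ π₂ hb₁ hb₂ hr₁ hr₂

end Summit.ResolutionOfSingularities.ResolutionOfSingularities.Theorems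

end
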